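import Summits.QuantumFields.BalabanUV.Beta.D1BFx.RestKernelSandwichLoc
import Summits.QuantumFields.BalabanUV.Beta.D1BFx.PackedDressingBridge

/-!
# `BalabanUV.Beta.D1BFx.RestBlockWordsLoc` — road «BF-x» for binder row D1, slot (K), DICT-CHAIN-SPEC §2 (II) row RK-BLK: **«RK-BLK AT SELF-LOCALISED
# PACKS» — THE 3 + 15 BLOCK WORDS AT THE ROAD's PACKED N-JETS `vertexOfK (NlegRoad m a) n S`, `vertex2OfK (NlegRoad m a) n S₂` UNDER ONE n-FREE LEG
# TRIPLE, WITH THE JETS' RATE QUANTIFIED (`0 ≤ σ ≤ c∕n`, bubbles at `σ·n`) AND WITH THE PACK LETTERS READ FROM THE STENCILS' SELF-LOCALISATION**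
# (`LocStencil S Cs δS`, the `LocStencil₂` body `BiLoc (S₂ κ u κ′ u′) u u (Ck·e^{−δ₂|u′−u|₁}) δ₂` — leaf-01's `RestKernelSandwichLoc` §1 conversions BY NAME;
# the twin, for the block channel, of leaf-01's `RestKernelSandwichPacked` v1.2 ∕ `RestKernelSandwichLoc` for the sandwich channel).

HONEST DEPENDENCY (cell records, verbatim): «continuum YM on T⁴ ⇐ BetaPertH ∧ nine spine estimates (0/9 proved); BetaPertH ⇐ (D1) ∧ (D4) ∧
CAP+tail; G-an2-4 gates asym, D1 and NE2/3/4.»  HONEST FRAMING (cell contract, verbatim): «discharging `BetaPertH` makes Bałaban's UV stability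
UNCONDITIONAL — a real constructive-QFT result; it is NOT the continuum limit and NOT the Clay problem.»  THIS MODULE DISCHARGES NOTHING of the
wall: [folklore] composition BY NAME of `RestKernelBlockUnit.exists_road_block_legs` ∕ `decay510_blockWord_inl_of_decays` ∕ `decay510_blockWord_inr`,
`RestJetBlockMass.mass_blk_vertexOfK_NlegRoad_le`, `RestTableBlockMass.mass_blk_vertex2OfK_NlegRoad_le` (leaf-04 g19) and `RestKernelSandwichLoc.mass_blk_le_of_locStencil`
∕ `mass_blk_le_of_body` (leaf-01 g22); §4 also `PackedDressingBridge.vertex2OfK_coDressKBmAt_eq_full` (OWNER d1-p2), `NlegKHessSplit.vertexOfK_NlegRoad_eq_vertexOf`,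
`OneStepKernelFamily.vertexOfK_KInv`, `BorderedHessian.KInvStep_zero_eq`; modulo the displayed [B5] hypotheses `h12` ∕ `h126`; 0 `sorry`, 0 definitions, 0 notation, nothing cited.
0 root-level binders of row D1 discharged (hW ∕ hR-sockets ∕ hSX-socket ∕ D1Tel ∕ D1Rep — 0); (K) NOT closed (the road's packs `coProjBmAtK ρ n (SN m a S)` ∕ `S₂^{ΠΠ}`
are instantiated by the consumer through the OWNER's PACK-BRIDGE, not here); NOT D1, NOT `BetaPertH`, NOT continuum, NOT Clay.

ABSOLUTE RULE (cell charter, verbatim): «No internally-minted statement may enter as a cited fact. Every hypothesis is either kernel-proved in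
this package or a verbatim quotation of a PUBLISHED theorem with page reference. The manuscript(s) under audit are NOT citable for their own
disputed steps — they are the thing under adjudication; programme-internal (2001/route/tribunal) claims are never citable.»

CONTENT (`n = m + 1`; `C₄ := MG163 4·periodConst (kappa163 4) 3`, `κ′ := kappa163 4∕4`, `C_V := 4·C₄·e^{κ′}·(1+16∕κ′)⁴`, `C_T(δ) := 16·(C₄e^{κ′})²·(1+16∕κ′)⁴·Zl 4 (δ∕2)`;
leg letters `L_ij := [ij = tt](kG∕2 + K∕2∕n²) + [ij ∈ {tf, ft}]·(n⁵)⁻¹·C₄e^{κ′} + [ij = ff]·2(n⁸)⁻¹·c166Z 3`):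
* §1 [mod `h12 ∧ h126`] **`exists_decay510_blockWord_packed`**: ONE n-free triple `kG, K ≥ 0`, `c > 0` (one call of `exists_road_block_legs`) such that for every `m`, `μ ν`:
  (tadpoles) for every pair pack with plain block letters `mT j i·e^{−δ|u′−u|₁}` (`0 < δ`) and ANY first jet `V`, `u = inl (i, j)`:
  `Decay510 … (½·(L_ij·(C_T(δ)·(n⁶)⁻¹·mT j i))) (min (κ′∕8) (δ∕2))`; (bubbles) for every rate `0 ≤ σ ≤ c∕n`, every first-jet pack with `σ`-weighted centred block
  masses `mS j k` and ANY table `W`, `u = inr (i, j, k, l)`: `Decay510 … (½·(L_ij·L_kl·(C_V·n⁻¹·mS j k)·(C_V·n⁻¹·mS l i))) (σ·n)` — the σ-QUANTIFIED twin of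
  `RestJetBlockMass.exists_decay510_blockWord_inr_packed` (which fixed `σ := c∕n`) joined with `RestTableBlockMass.exists_decay510_blockWord_inl_packed` under ONE triple.
* §3 [mod `h12 ∧ h126`] **`exists_rows_blockWord_road_loc`**: the (1.22) read-out of §2 — `AbsMoment₂` (the `hMR` row shape) and `|secondMoment| ≤ (constant)·Σ'_x |x|₁²e^{−rate|x|₁}`
  (the `hU` row shape) for all eighteen words, by `absMoment₂_of_decay510` ∕ `secondMoment_abs_le_of_decay510` — the rows leaf-01's `Rk`-member wiring consumes.
* §4 [mod `h12 ∧ h126`] **N-SIDE TABLE BRIDGE** (hosted here on the OWNER's word W-d1p2-g18-12 «HOST IT»): `vertex2OfK_NlegRoad_eq_vertex2OfK_KInvStep`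
  (`vertex2OfK (NlegRoad m a) n T = vertex2OfK (KInvStep n 0) n T` — `vertexOfK_NlegRoad_eq_vertexOf` ∕ `vertexOfK_KInv` in both slots) and
  **`vertex2OfK_G₀_eq_vertex2OfK_NlegRoad`** (`vertex2OfK G₀ n S₂ = vertex2OfK (NlegRoad m a) n S₂^{ΠΠ}`, BRIDGE §5 `vertex2OfK_coDressKBmAt_eq_full` BY NAME) — the line from
  PART 4's ∕ (D)-II's second table to the `W`-slot of §2∕§3 (letters of `S₂^{ΠΠ}`: `PairPackDressing.locStencil₂_coProjBmAtK₂`).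
* §2 [mod `h12 ∧ h126`] **`exists_decay510_blockWord_road_loc`**: the same at the road's packed PAIR `V := vertexOfK (NlegRoad m a) n S`, `W := vertex2OfK (NlegRoad m a) n S₂`
  for `LocStencil S Cs δS` and a pair pack body `(Ck, δ₂)`: tadpoles with `mT := 16·Ck·Zl 4 (δ₂∕2)²` at rate `min (κ′∕8) (δ₂∕2)`, bubbles with `mS := 16·Cs·Zl 4 (δS∕2)²`
  at the n-FREE rate `min c (δS∕2)` (jets' rate `σ := min c (δS∕2)∕n` inside) — NET `n⁻⁶·n^{legs}` ∕ `n⁻²·n^{legs}` with every genuine word carrying one displayed `n⁻⁵` leg.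
Unit `b2b-balaban-beta-d1-formalise-leaf-04` (gen 19), D1 formalisation swarm leaf prover 04, road «BF-x»; INTENT «RK-BLK AT SELF-LOCALISED PACKS» (journal).
-/

noncomputable section

open Finset
open scoped BigOperators
open Literature.MathematicalPhysics.QuantumFieldTheory.Balaban1983to89
open Literature.MathematicalPhysics.QuantumFieldTheory.Balaban1983to89.Beta
open B12Sec2to5 (l1 l1_nonneg Decay510 secondMoment_abs_le_of_decay510)
open DecimatedMomentSummable (AbsMoment₂ absMoment₂_of_decay510)
open B5Hk163Strip (kappa163 kappa163_pos)
open B5Hk163Decay (MG163)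
open B4TorusKernel (periodConst)
open ExpKernelCalculus (Site MKer BiLoc Decays Zl)
open SecondOrderResponse (vertex2OfK)
open AffineAveraging (box toSite)
open OneStepResolventKernel (Fib KInv vertexOf LocStencil)
open OneStepKernelFamily (KInvStep vertexOfK vertexOfK_KInv decays_KInvStep)
open BalabanCompositeJets (LocStencil₂)
open VectorTailsLoc (fam kfam)
open Summit.QuantumFields.BalabanUV.Beta.TameKernelCalculus (decays_of_le)
open Summit.QuantumFields.BalabanUV.Beta.D1BFx.PackedKernelSplit (blk)
open Summit.QuantumFields.BalabanUV.Beta.D1BFx.RWeightedLegPack (NlegRoad)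
open Summit.QuantumFields.BalabanUV.Beta.D1BFx.FrozenLegTails (nOf MOf hn1)
open Summit.QuantumFields.BalabanUV.Beta.GAN24.DirichletExhaustionDeltaZ (c166Z)
open Summit.QuantumFields.BalabanUV.Beta.D1BFx.RestKernelWords (blockWord)
open Summit.QuantumFields.BalabanUV.Beta.D1BFx.RestKernelBlockUnit (exists_road_block_legs decay510_blockWord_inl_of_decays decay510_blockWord_inr)
open Summit.QuantumFields.BalabanUV.Beta.D1BFx.RestJetBlockMass (mass_blk_vertexOfK_NlegRoad_le)
open Summit.QuantumFields.BalabanUV.Beta.D1BFx.RestTableBlockMass (mass_blk_vertex2OfK_NlegRoad_le)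
open Summit.QuantumFields.BalabanUV.Beta.D1BFx.RestKernelSandwichLoc (mass_blk_le_of_locStencil mass_blk_le_of_body)
open Summit.QuantumFields.BalabanUV.Beta.AxialDressingRooted (coDressKBmAt coProjBmAtK one_le_of_neZero)
open Summit.QuantumFields.BalabanUV.Beta.BorderedHessian (KInvStep_zero_eq)
open Summit.QuantumFields.BalabanUV.Beta.D1BFx.NlegKHessSplit (vertexOfK_NlegRoad_eq_vertexOf)
open Summit.QuantumFields.BalabanUV.Beta.D1BFx.PackedDressingBridge (vertex2OfK_coDressKBmAt_eq_full)

namespace Summit.QuantumFields.BalabanUV.Beta.D1BFx.RestBlockWordsLoc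

variable {a : ℝ} (ha : 0 < a)
include ha

/-! ## §1 All eighteen block words under ONE leg triple, jets' rate quantified -/

/-- [folklore] **THE 3 + 15 BLOCK WORDS AT THE ROAD's PACKED JETS, ONE n-FREE LEG TRIPLE, σ QUANTIFIED** (mod [B5, Prop. 1.2] ∧ [B5, (1.126)–(1.127)] BY NAME).
ONE call of `exists_road_block_legs` (`c` shrunk below `kappa163 4∕64` so that every admissible jets' rate `σ ≤ c∕n` is below the packing threshold `κ′∕(16n)`):
(tadpoles, `u = inl (i, j)`) `RestTableBlockMass.mass_blk_vertex2OfK_NlegRoad_le` into `decay510_blockWord_inl_of_decays` — any first jet `V`, rate `min (κ′∕8) (δ∕2)`;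
(bubbles, `u = inr (i, j, k, l)`) `RestJetBlockMass.mass_blk_vertexOfK_NlegRoad_le` into `decay510_blockWord_inr` at the rate `σ` — any table `W`, rate `σ·n`. -/
theorem exists_decay510_blockWord_packed (h12 : B5.Prop12Printed (fam nOf hn1 MOf a ha)) (h126 : B5.Kernel126_127Printed (kfam nOf MOf)) :
    ∃ kG K c : ℝ, 0 < c ∧ 0 ≤ kG ∧ 0 ≤ K ∧ ∀ (m : ℕ) (μ ν : Fin 4),
      (∀ (S₂ : Fin 4 → Site 4 → Fin 4 → Site 4 → MKer 4 (Fib 3)) (V : Fin 4 → Site 4 → MKer 4 (Fib 3)) (δ : ℝ) (mT : Bool → Bool → ℝ),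
        0 < δ →
        (∀ κ u κ' u' j i, Summable fun p : Site 4 × Site 4 => ∑ g, ∑ f, |blk (S₂ κ u κ' u') j i p.1 p.2 g f|) →
        (∀ κ u κ' u' j i, ∑' p : Site 4 × Site 4, ∑ g, ∑ f, |blk (S₂ κ u κ' u') j i p.1 p.2 g f| ≤ mT j i * Real.exp (-δ * l1 (u' - u))) →
        ∀ i j : Bool, Decay510 (blockWord (NlegRoad m a) V (vertex2OfK (NlegRoad m a) (m + 1) S₂) (Sum.inl (i, j)) μ ν)
          ((1 / 2) * ((bif (i && j) then kG / 2 + K / 2 / (((m + 1 : ℕ) : ℝ)) ^ 2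
              else bif (i || j) then ((((m + 1 : ℕ) : ℝ)) ^ 5)⁻¹ * (MG163 4 * periodConst (kappa163 4) 3) * Real.exp (kappa163 4 / 4)
              else 2 * ((((m + 1 : ℕ) : ℝ)) ^ 8)⁻¹ * c166Z 3)
            * (16 * ((MG163 4 * periodConst (kappa163 4) 3) * Real.exp (kappa163 4 / 4)) ^ 2 * (1 + 16 / (kappa163 4 / 4)) ^ 4 * Zl 4 (δ / 2)
                * ((((m + 1 : ℕ) : ℝ)) ^ 6)⁻¹ * mT j i)))
          (min (kappa163 4 / 4 / 8) (δ / 2))) ∧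
      (∀ (S : Fin 4 → Site 4 → MKer 4 (Fib 3)) (W : Fin 4 → Site 4 → Fin 4 → Site 4 → MKer 4 (Fib 3)) (σ : ℝ) (mS : Bool → Bool → ℝ),
        0 ≤ σ → σ ≤ c / ((m + 1 : ℕ) : ℝ) →
        (∀ κ' u j k, Summable fun p : Site 4 × Site 4 =>
          ∑ g, ∑ f, |blk (S κ' u) j k p.1 p.2 g f| * Real.exp (σ * (l1 (p.1 - u) + l1 (p.2 - u)))) →
        (∀ κ' u j k, ∑' p : Site 4 × Site 4,
          ∑ g, ∑ f, |blk (S κ' u) j k p.1 p.2 g f| * Real.exp (σ * (l1 (p.1 - u) + l1 (p.2 - u))) ≤ mS j k) →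
        ∀ i j k l : Bool, Decay510 (blockWord (NlegRoad m a) (vertexOfK (NlegRoad m a) (m + 1) S) W (Sum.inr (i, j, k, l)) μ ν)
          ((1 / 2) * ((bif (i && j) then kG / 2 + K / 2 / (((m + 1 : ℕ) : ℝ)) ^ 2
              else bif (i || j) then ((((m + 1 : ℕ) : ℝ)) ^ 5)⁻¹ * (MG163 4 * periodConst (kappa163 4) 3) * Real.exp (kappa163 4 / 4)
              else 2 * ((((m + 1 : ℕ) : ℝ)) ^ 8)⁻¹ * c166Z 3)
            * (bif (k && l) then kG / 2 + K / 2 / (((m + 1 : ℕ) : ℝ)) ^ 2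
              else bif (k || l) then ((((m + 1 : ℕ) : ℝ)) ^ 5)⁻¹ * (MG163 4 * periodConst (kappa163 4) 3) * Real.exp (kappa163 4 / 4)
              else 2 * ((((m + 1 : ℕ) : ℝ)) ^ 8)⁻¹ * c166Z 3)
            * (4 * (MG163 4 * periodConst (kappa163 4) 3) * Real.exp (kappa163 4 / 4) * (1 + 16 / (kappa163 4 / 4)) ^ 4
                * (((m + 1 : ℕ) : ℝ))⁻¹ * mS j k)
            * (4 * (MG163 4 * periodConst (kappa163 4) 3) * Real.exp (kappa163 4 / 4) * (1 + 16 / (kappa163 4 / 4)) ^ 4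
                * (((m + 1 : ℕ) : ℝ))⁻¹ * mS l i)))
          (σ * ((m + 1 : ℕ) : ℝ))) := by
  obtain ⟨kG, K, c₁, hc₁, hkG, hK, hlegs⟩ := exists_road_block_legs ha h12 h126
  have hκ : 0 < kappa163 4 := kappa163_pos 4
  refine ⟨kG, K, min c₁ (kappa163 4 / 64), lt_min hc₁ (by positivity), hkG, hK, fun m μ ν => ⟨?_, ?_⟩⟩
  · -- the three tadpole words: any first jet, the packed table
    intro S₂ V δ mT hδ hTs hTm i j
    have hn0 : (0 : ℝ) < ((m + 1 : ℕ) : ℝ) := by exact_mod_cast Nat.succ_pos m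
    have hσ0 : 0 ≤ c₁ / ((m + 1 : ℕ) : ℝ) := by positivity
    have hT0 : ∀ i j, 0 ≤ (bif (i && j) then kG / 2 + K / 2 / (((m + 1 : ℕ) : ℝ)) ^ 2
        else bif (i || j) then ((((m + 1 : ℕ) : ℝ)) ^ 5)⁻¹ * (MG163 4 * periodConst (kappa163 4) 3) * Real.exp (kappa163 4 / 4)
        else 2 * ((((m + 1 : ℕ) : ℝ)) ^ 8)⁻¹ * c166Z 3) := fun i j => (hlegs m i j).nonneg 0
    have hW := fun z j' i' => mass_blk_vertex2OfK_NlegRoad_le m ha h12 h126 hδ hTs hTm μ 0 ν z j' i'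
    refine decay510_blockWord_inl_of_decays (K := NlegRoad m a) (V := V) (W := vertex2OfK (NlegRoad m a) (m + 1) S₂)
      (mW := fun j i => 16 * ((MG163 4 * periodConst (kappa163 4) 3) * Real.exp (kappa163 4 / 4)) ^ 2 * (1 + 16 / (kappa163 4 / 4)) ^ 4
        * Zl 4 (δ / 2) * ((((m + 1 : ℕ) : ℝ)) ^ 6)⁻¹ * mT j i)
      (fun i j => hlegs m i j) hσ0 hT0 μ ν (fun z j' i' => (hW z j' i').1) (fun z j' i' => ?_) i j
    have h := (hW z j' i').2
    rwa [sub_zero] at h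
  · -- the fifteen bubble words: the packed first jets at the rate `σ`, any table
    intro S W σ mS hσ0 hσc hSs hSm i j k l
    have hn0 : (0 : ℝ) < ((m + 1 : ℕ) : ℝ) := by exact_mod_cast Nat.succ_pos m
    have hσ1 : σ ≤ c₁ / ((m + 1 : ℕ) : ℝ) := hσc.trans (div_le_div_of_nonneg_right (min_le_left _ _) hn0.le)
    have hσκ : σ ≤ kappa163 4 / 4 / (16 * ((m + 1 : ℕ) : ℝ)) := by
      calc σ ≤ min c₁ (kappa163 4 / 64) / ((m + 1 : ℕ) : ℝ) := hσc
        _ ≤ (kappa163 4 / 64) / ((m + 1 : ℕ) : ℝ) := div_le_div_of_nonneg_right (min_le_right _ _) hn0.le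
        _ = kappa163 4 / 4 / (16 * ((m + 1 : ℕ) : ℝ)) := by ring
    -- the leg table at blocking `n`, at the rate `σ ≤ c₁∕n`
    set T : Bool → Bool → ℝ := fun i j =>
      bif (i && j) then kG / 2 + K / 2 / (((m + 1 : ℕ) : ℝ)) ^ 2
        else bif (i || j) then ((((m + 1 : ℕ) : ℝ)) ^ 5)⁻¹ * (MG163 4 * periodConst (kappa163 4) 3) * Real.exp (kappa163 4 / 4)
        else 2 * ((((m + 1 : ℕ) : ℝ)) ^ 8)⁻¹ * c166Z 3 with hT
    have hT0 : ∀ i j, 0 ≤ T i j := fun i j => (hlegs m i j).nonneg 0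
    have hKσ : ∀ i j, Decays (blk (NlegRoad m a) i j) (T i j) σ := fun i j => by
      have h := decays_of_le (hlegs m i j) hσ1
      rwa [abs_of_nonneg (hT0 i j)] at h
    have hV := fun ρ y j' k' => mass_blk_vertexOfK_NlegRoad_le m ha h12 h126 (mS := mS) hσ0 hσκ hSs hSm ρ y j' k'
    exact decay510_blockWord_inr (K := NlegRoad m a) (V := vertexOfK (NlegRoad m a) (m + 1) S) (W := W) (N := m + 1)
      (mV := fun j k => 4 * (MG163 4 * periodConst (kappa163 4) 3) * Real.exp (kappa163 4 / 4) * (1 + 16 / (kappa163 4 / 4)) ^ 4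
        * (((m + 1 : ℕ) : ℝ))⁻¹ * mS j k)
      hKσ hσ0 hT0 μ ν (fun ρ y j' k' => (hV ρ y j' k').1) (fun ρ y j' k' => (hV ρ y j' k').2) i j k l

/-! ## §2 The road's packed pair at self-localised packs -/

/-- [folklore] **«RK-BLK AT SELF-LOCALISED PACKS»** (mod [B5, Prop. 1.2] ∧ [B5, (1.126)–(1.127)] BY NAME): with the triple of §1, for every `m`, every self-localised
first-jet pack `LocStencil S Cs δS` (`0 ≤ Cs`, `0 < δS`) and every pair pack with the `LocStencil₂` body `(Ck, δ₂)` (`0 ≤ Ck`, `0 < δ₂`), the eighteen block words at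
the road's packed pair `V := vertexOfK (NlegRoad m a) n S`, `W := vertex2OfK (NlegRoad m a) n S₂` satisfy: tadpoles
`Decay510 … (½·(L_ij·(C_T(δ₂)·(n⁶)⁻¹·(16·Ck·Zl 4 (δ₂∕2)²)))) (min (κ′∕8) (δ₂∕2))`, bubbles `Decay510 … (½·(L_ij·L_kl·M·M)) (min c (δS∕2))`,
`M := C_V·n⁻¹·(16·Cs·Zl 4 (δS∕2)²)` — §1 at the jets' rate `σ := min c (δS∕2)∕n` with the letters of `RestKernelSandwichLoc.mass_blk_le_of_locStencil` ∕ `mass_blk_le_of_body`. -/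
theorem exists_decay510_blockWord_road_loc (h12 : B5.Prop12Printed (fam nOf hn1 MOf a ha)) (h126 : B5.Kernel126_127Printed (kfam nOf MOf)) :
    ∃ kG K c : ℝ, 0 < c ∧ 0 ≤ kG ∧ 0 ≤ K ∧ ∀ (m : ℕ) (S : Fin 4 → Site 4 → MKer 4 (Fib 3))
      (S₂ : Fin 4 → Site 4 → Fin 4 → Site 4 → MKer 4 (Fib 3)) (Cs δS Ck δ₂ : ℝ) (μ ν : Fin 4),
      LocStencil S Cs δS → 0 ≤ Cs → 0 < δS →
      (∀ κ u κ' u', BiLoc (S₂ κ u κ' u') u u (Ck * Real.exp (-δ₂ * l1 (u' - u))) δ₂) → 0 ≤ Ck → 0 < δ₂ →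
      (∀ i j : Bool, Decay510 (blockWord (NlegRoad m a) (vertexOfK (NlegRoad m a) (m + 1) S) (vertex2OfK (NlegRoad m a) (m + 1) S₂)
          (Sum.inl (i, j)) μ ν)
          ((1 / 2) * ((bif (i && j) then kG / 2 + K / 2 / (((m + 1 : ℕ) : ℝ)) ^ 2
              else bif (i || j) then ((((m + 1 : ℕ) : ℝ)) ^ 5)⁻¹ * (MG163 4 * periodConst (kappa163 4) 3) * Real.exp (kappa163 4 / 4)
              else 2 * ((((m + 1 : ℕ) : ℝ)) ^ 8)⁻¹ * c166Z 3)
            * (16 * ((MG163 4 * periodConst (kappa163 4) 3) * Real.exp (kappa163 4 / 4)) ^ 2 * (1 + 16 / (kappa163 4 / 4)) ^ 4 * Zl 4 (δ₂ / 2)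
                * ((((m + 1 : ℕ) : ℝ)) ^ 6)⁻¹ * (16 * Ck * Zl 4 (δ₂ / 2) ^ 2))))
          (min (kappa163 4 / 4 / 8) (δ₂ / 2))) ∧
      (∀ i j k l : Bool, Decay510 (blockWord (NlegRoad m a) (vertexOfK (NlegRoad m a) (m + 1) S) (vertex2OfK (NlegRoad m a) (m + 1) S₂)
          (Sum.inr (i, j, k, l)) μ ν)
          ((1 / 2) * ((bif (i && j) then kG / 2 + K / 2 / (((m + 1 : ℕ) : ℝ)) ^ 2
              else bif (i || j) then ((((m + 1 : ℕ) : ℝ)) ^ 5)⁻¹ * (MG163 4 * periodConst (kappa163 4) 3) * Real.exp (kappa163 4 / 4)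
              else 2 * ((((m + 1 : ℕ) : ℝ)) ^ 8)⁻¹ * c166Z 3)
            * (bif (k && l) then kG / 2 + K / 2 / (((m + 1 : ℕ) : ℝ)) ^ 2
              else bif (k || l) then ((((m + 1 : ℕ) : ℝ)) ^ 5)⁻¹ * (MG163 4 * periodConst (kappa163 4) 3) * Real.exp (kappa163 4 / 4)
              else 2 * ((((m + 1 : ℕ) : ℝ)) ^ 8)⁻¹ * c166Z 3)
            * (4 * (MG163 4 * periodConst (kappa163 4) 3) * Real.exp (kappa163 4 / 4) * (1 + 16 / (kappa163 4 / 4)) ^ 4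
                * (((m + 1 : ℕ) : ℝ))⁻¹ * (16 * Cs * Zl 4 (δS / 2) ^ 2))
            * (4 * (MG163 4 * periodConst (kappa163 4) 3) * Real.exp (kappa163 4 / 4) * (1 + 16 / (kappa163 4 / 4)) ^ 4
                * (((m + 1 : ℕ) : ℝ))⁻¹ * (16 * Cs * Zl 4 (δS / 2) ^ 2))))
          (min c (δS / 2))) := by
  obtain ⟨kG, K, c, hc, hkG, hK, hpk⟩ := exists_decay510_blockWord_packed ha h12 h126
  refine ⟨kG, K, c, hc, hkG, hK, fun m S S₂ Cs δS Ck δ₂ μ ν hS hCs hδS hS₂ hCk hδ₂ => ?_⟩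
  obtain ⟨hinl, hinr⟩ := hpk m μ ν
  have hn0 : (0 : ℝ) < ((m + 1 : ℕ) : ℝ) := by exact_mod_cast Nat.succ_pos m
  have hn1 : (1 : ℝ) ≤ ((m + 1 : ℕ) : ℝ) := by exact_mod_cast Nat.succ_le_succ (Nat.zero_le m)
  -- the jets' rate `σ := min c (δS∕2)∕n`: below `c∕n` and below `δS∕2`
  set σ : ℝ := min c (δS / 2) / ((m + 1 : ℕ) : ℝ) with hσdef
  have hmin0 : 0 < min c (δS / 2) := lt_min hc (half_pos hδS)
  have hσ0 : 0 ≤ σ := by positivity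
  have hσc : σ ≤ c / ((m + 1 : ℕ) : ℝ) := div_le_div_of_nonneg_right (min_le_left _ _) hn0.le
  have hσS : σ ≤ δS / 2 := by
    calc σ ≤ min c (δS / 2) / 1 := div_le_div_of_nonneg_left hmin0.le one_pos hn1
      _ ≤ δS / 2 := by rw [div_one]; exact min_le_right _ _
  -- the pack letters from self-localisation (leaf-01's §1)
  have hV := fun κ' u j k => mass_blk_le_of_locStencil (σ := σ) hS hCs hδS hσS κ' u j k
  have hT := fun κ u κ' u' j i => mass_blk_le_of_body hS₂ hCk hδ₂ κ u κ' u' j i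
  refine ⟨fun i j => hinl S₂ (vertexOfK (NlegRoad m a) (m + 1) S) δ₂ (fun _ _ => 16 * Ck * Zl 4 (δ₂ / 2) ^ 2) hδ₂
      (fun κ u κ' u' j i => (hT κ u κ' u' j i).1) (fun κ u κ' u' j i => (hT κ u κ' u' j i).2) i j, fun i j k l => ?_⟩
  have h := hinr S (vertex2OfK (NlegRoad m a) (m + 1) S₂) σ (fun _ _ => 16 * Cs * Zl 4 (δS / 2) ^ 2) hσ0 hσc
    (fun κ' u j k => (hV κ' u j k).1) (fun κ' u j k => (hV κ' u j k).2) i j k l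
  have e : σ * ((m + 1 : ℕ) : ℝ) = min c (δS / 2) := div_mul_cancel₀ _ hn0.ne'
  rw [e] at h
  exact h

/-! ## §3 The (1.22) rows of the eighteen block words at self-localised packs -/

/-- [folklore] **THE (1.22) ROWS OF THE BLOCK WORDS AT SELF-LOCALISED PACKS** (mod [B5, Prop. 1.2] ∧ [B5, (1.126)–(1.127)] BY NAME): with the triple of §2, every
block word at the road's packed pair has an absolutely summable second moment (`AbsMoment₂`, the joint root's `hMR` row shape) and
`|secondMoment| ≤ (its (5.10) constant)·Σ'_x |x|₁²·e^{−rate·|x|₁}` (the `hU` row shape) — tadpoles at the rate `min (κ′∕8) (δ₂∕2)`, bubbles at `min c (δS∕2)`,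
both n-free and positive. -/
theorem exists_rows_blockWord_road_loc (h12 : B5.Prop12Printed (fam nOf hn1 MOf a ha)) (h126 : B5.Kernel126_127Printed (kfam nOf MOf)) :
    ∃ kG K c : ℝ, 0 < c ∧ 0 ≤ kG ∧ 0 ≤ K ∧ ∀ (m : ℕ) (S : Fin 4 → Site 4 → MKer 4 (Fib 3))
      (S₂ : Fin 4 → Site 4 → Fin 4 → Site 4 → MKer 4 (Fib 3)) (Cs δS Ck δ₂ : ℝ) (μ ν : Fin 4),
      LocStencil S Cs δS → 0 ≤ Cs → 0 < δS →
      (∀ κ u κ' u', BiLoc (S₂ κ u κ' u') u u (Ck * Real.exp (-δ₂ * l1 (u' - u))) δ₂) → 0 ≤ Ck → 0 < δ₂ →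
      (∀ i j : Bool,
        AbsMoment₂ (blockWord (NlegRoad m a) (vertexOfK (NlegRoad m a) (m + 1) S) (vertex2OfK (NlegRoad m a) (m + 1) S₂) (Sum.inl (i, j)) μ ν) ∧
        |B12Beta.secondMoment (blockWord (NlegRoad m a) (vertexOfK (NlegRoad m a) (m + 1) S) (vertex2OfK (NlegRoad m a) (m + 1) S₂)
            (Sum.inl (i, j))) μ ν|
          ≤ (1 / 2) * ((bif (i && j) then kG / 2 + K / 2 / (((m + 1 : ℕ) : ℝ)) ^ 2
              else bif (i || j) then ((((m + 1 : ℕ) : ℝ)) ^ 5)⁻¹ * (MG163 4 * periodConst (kappa163 4) 3) * Real.exp (kappa163 4 / 4)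
              else 2 * ((((m + 1 : ℕ) : ℝ)) ^ 8)⁻¹ * c166Z 3)
            * (16 * ((MG163 4 * periodConst (kappa163 4) 3) * Real.exp (kappa163 4 / 4)) ^ 2 * (1 + 16 / (kappa163 4 / 4)) ^ 4 * Zl 4 (δ₂ / 2)
                * ((((m + 1 : ℕ) : ℝ)) ^ 6)⁻¹ * (16 * Ck * Zl 4 (δ₂ / 2) ^ 2)))
            * ∑' x : Site 4, l1 x ^ 2 * Real.exp (-(min (kappa163 4 / 4 / 8) (δ₂ / 2)) * l1 x)) ∧
      (∀ i j k l : Bool,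
        AbsMoment₂ (blockWord (NlegRoad m a) (vertexOfK (NlegRoad m a) (m + 1) S) (vertex2OfK (NlegRoad m a) (m + 1) S₂)
          (Sum.inr (i, j, k, l)) μ ν) ∧
        |B12Beta.secondMoment (blockWord (NlegRoad m a) (vertexOfK (NlegRoad m a) (m + 1) S) (vertex2OfK (NlegRoad m a) (m + 1) S₂)
            (Sum.inr (i, j, k, l))) μ ν|
          ≤ (1 / 2) * ((bif (i && j) then kG / 2 + K / 2 / (((m + 1 : ℕ) : ℝ)) ^ 2
              else bif (i || j) then ((((m + 1 : ℕ) : ℝ)) ^ 5)⁻¹ * (MG163 4 * periodConst (kappa163 4) 3) * Real.exp (kappa163 4 / 4)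
              else 2 * ((((m + 1 : ℕ) : ℝ)) ^ 8)⁻¹ * c166Z 3)
            * (bif (k && l) then kG / 2 + K / 2 / (((m + 1 : ℕ) : ℝ)) ^ 2
              else bif (k || l) then ((((m + 1 : ℕ) : ℝ)) ^ 5)⁻¹ * (MG163 4 * periodConst (kappa163 4) 3) * Real.exp (kappa163 4 / 4)
              else 2 * ((((m + 1 : ℕ) : ℝ)) ^ 8)⁻¹ * c166Z 3)
            * (4 * (MG163 4 * periodConst (kappa163 4) 3) * Real.exp (kappa163 4 / 4) * (1 + 16 / (kappa163 4 / 4)) ^ 4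
                * (((m + 1 : ℕ) : ℝ))⁻¹ * (16 * Cs * Zl 4 (δS / 2) ^ 2))
            * (4 * (MG163 4 * periodConst (kappa163 4) 3) * Real.exp (kappa163 4 / 4) * (1 + 16 / (kappa163 4 / 4)) ^ 4
                * (((m + 1 : ℕ) : ℝ))⁻¹ * (16 * Cs * Zl 4 (δS / 2) ^ 2)))
            * ∑' x : Site 4, l1 x ^ 2 * Real.exp (-(min c (δS / 2)) * l1 x)) := by
  obtain ⟨kG, K, c, hc, hkG, hK, hloc⟩ := exists_decay510_blockWord_road_loc ha h12 h126
  refine ⟨kG, K, c, hc, hkG, hK, fun m S S₂ Cs δS Ck δ₂ μ ν hS hCs hδS hS₂ hCk hδ₂ => ?_⟩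
  obtain ⟨hinl, hinr⟩ := hloc m S S₂ Cs δS Ck δ₂ μ ν hS hCs hδS hS₂ hCk hδ₂
  have hκ0 : 0 < kappa163 4 := kappa163_pos 4
  have hκ : 0 < min (kappa163 4 / 4 / 8) (δ₂ / 2) := lt_min (by positivity) (half_pos hδ₂)
  have hcS : 0 < min c (δS / 2) := lt_min hc (half_pos hδS)
  refine ⟨fun i j => ⟨absMoment₂_of_decay510 hκ (hinl i j), ?_⟩, fun i j k l => ⟨absMoment₂_of_decay510 hcS (hinr i j k l), ?_⟩⟩
  · exact (secondMoment_abs_le_of_decay510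
      (P := blockWord (NlegRoad m a) (vertexOfK (NlegRoad m a) (m + 1) S) (vertex2OfK (NlegRoad m a) (m + 1) S₂) (Sum.inl (i, j)))
      hκ (hinl i j)).2
  · exact (secondMoment_abs_le_of_decay510
      (P := blockWord (NlegRoad m a) (vertexOfK (NlegRoad m a) (m + 1) S) (vertex2OfK (NlegRoad m a) (m + 1) S₂) (Sum.inr (i, j, k, l)))
      hcS (hinr i j k l)).2

/-! ## §4 The N-side table bridge (hosted here on the OWNER's word W-d1p2-g18-12) -/

/-- [folklore] **THE BI-VERTEX THROUGH THE N-LEG's `ℋ_R`-COLUMNS IS THE BI-VERTEX THROUGH `KInv`'s** (mod [B5, Prop. 1.2] ∧ [B5, (1.126)–(1.127)] BY NAME):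
`vertex2OfK (NlegRoad m a) (m+1) T = vertex2OfK (KInvStep (m+1) 0) (m+1) T` — `vertexOfK_NlegRoad_eq_vertexOf` ∕ `KInvStep_zero_eq` ∕ `vertexOfK_KInv` in the inner
and in the outer slot. -/
theorem vertex2OfK_NlegRoad_eq_vertex2OfK_KInvStep (m : ℕ) (h12 : B5.Prop12Printed (fam nOf hn1 MOf a ha))
    (h126 : B5.Kernel126_127Printed (kfam nOf MOf)) (T : Fin 4 → (Fin 4 → ℤ) → Fin 4 → (Fin 4 → ℤ) → MKer 4 (Fib 3))
    (μ : Fin 4) (y : Fin 4 → ℤ) (ν : Fin 4) (y' : Fin 4 → ℤ) :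
    vertex2OfK (NlegRoad m a) (m + 1) T μ y ν y' = vertex2OfK (KInvStep (d := 3) (m + 1) 0) (m + 1) T μ y ν y' := by
  unfold vertex2OfK
  have hin : (fun κ u => vertexOfK (NlegRoad m a) (m + 1) (T κ u) ν y')
      = fun κ u => vertexOfK (KInvStep (d := 3) (m + 1) 0) (m + 1) (T κ u) ν y' := by
    funext κ u
    rw [vertexOfK_NlegRoad_eq_vertexOf m ha h12 h126, KInvStep_zero_eq, vertexOfK_KInv]
  rw [hin, vertexOfK_NlegRoad_eq_vertexOf m ha h12 h126, KInvStep_zero_eq, vertexOfK_KInv]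

/-- [folklore] **N-SIDE TABLE BRIDGE** (mod [B5, Prop. 1.2] ∧ [B5, (1.126)–(1.127)] BY NAME): for a `LocStencil₂` pair pack `S₂` (`0 < δ₂`) and an in-block root `r`,
`vertex2OfK G₀ (m+1) S₂ μ y ν y′ = vertex2OfK (NlegRoad m a) (m+1) S₂^{ΠΠ} μ y ν y′`, `G₀ := coDressKBmAt (toSite r) (m+1) (KInvStep (m+1) 0)`,
`S₂^{ΠΠ} κ u κ′ u′ := Πᵀ_bm (κ₀ u₀ ↦ Πᵀ_bm (S₂ κ₀ u₀) κ′ u′) κ u` (the OWNER's BRIDGE §5 `vertex2OfK_coDressKBmAt_eq_full` + the lemma above) — PART 4's ∕ (D)-II's second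
table in the `W`-slot currency of §2 ∕ §3 (`PairPackDressing.locStencil₂_coProjBmAtK₂` supplies the letters of `S₂^{ΠΠ}`). -/
theorem vertex2OfK_G₀_eq_vertex2OfK_NlegRoad (m : ℕ) {r : Fin 4 → ℕ} (hr : r ∈ box (3 + 1) (m + 1))
    (h12 : B5.Prop12Printed (fam nOf hn1 MOf a ha)) (h126 : B5.Kernel126_127Printed (kfam nOf MOf))
    {S₂ : Fin 4 → (Fin 4 → ℤ) → Fin 4 → (Fin 4 → ℤ) → MKer 4 (Fib 3)} {C₂ δ₂ : ℝ} (hS₂ : LocStencil₂ S₂ C₂ δ₂) (hδ₂ : 0 < δ₂)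
    (μ : Fin 4) (y : Fin 4 → ℤ) (ν : Fin 4) (y' : Fin 4 → ℤ) :
    vertex2OfK (coDressKBmAt (toSite r) (m + 1) (KInvStep (d := 3) (m + 1) 0)) (m + 1) S₂ μ y ν y'
      = vertex2OfK (NlegRoad m a) (m + 1)
          (fun κ u κ' u' => coProjBmAtK (toSite r) (m + 1) (fun κ₀ u₀ => coProjBmAtK (toSite r) (m + 1) (S₂ κ₀ u₀) κ' u') κ u) μ y ν y' := by
  obtain ⟨δ, C, hδ, hC, hK⟩ := decays_KInvStep (d := 3) (Lc := m + 1) 0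
  rw [vertex2OfK_coDressKBmAt_eq_full (one_le_of_neZero (m + 1)) hr hK hC hδ hS₂ hδ₂ μ y ν y',
    vertex2OfK_NlegRoad_eq_vertex2OfK_KInvStep ha m h12 h126]

end Summit.QuantumFields.BalabanUV.Beta.D1BFx.RestBlockWordsLoc

end
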